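import Summits.Ventures.QEC.Census.CertCoverBatch
import Summits.Ventures.QEC.Census.BB.A1s_n192_k4_0fa3ae82.CoreDefs
import HarnessLib

set_option Elab.async false
set_option maxRecDepth 200000

/-!
# `[[192,4,18]]` one-level cover certificate — LEVEL-1→0 coset problems 11…20 (problem 1 excluded: `Prob1.lean`) as COMPACT data
(`ProbData`: U, f, σ, y₀, allow; qec-type-10 `CertCoverBatch.mkCoset` rebuilds each `CosetProb` in the kernel) + their verdict
`probsOK cov covR hx hx1 D1 lxd 16` (one `decide +kernel`). qec-search-9 g5 (lead block 170 (0)(c)); data from JSON `level10.problems`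
(sha256 08367568…). Data + decided check; KERNEL.
-/

namespace Summit.Ventures.QEC.Census.A1s_n192_k4_0fa3ae82

open Matrix Summit.Ventures.QEC.Census Literature.InformationTheory.QuantumCodes

/-- Problems 11…20 (10): `⟨U, f, σ, y₀, allow⟩`. -/
def probs00b : List ProbData := [
    ⟨1047931385538784256, 0, 0, 0, [0]⟩,
    ⟨1266936467062556776, 0, 26388285882368, 1152939096797085696, [0]⟩,
    ⟨1556275253608244224, 0, 0, 0, [0]⟩,
    ⟨1842253795586262016, 2, 0, 0, [0]⟩,
    ⟨1914874348167613440, 0, 0, 0, [0]⟩,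
    ⟨3004182636887819264, 1, 0, 0, [0, 32768, 1152921504606846976]⟩,
    ⟨3576139720843854848, 3, 0, 0, [0, 32768]⟩,
    ⟨3648760273425206272, 1, 0, 0, [0, 32768, 72057594037927936]⟩,
    ⟨3757413999696708378, 0, 6597071470592, 1407374984217370, [0]⟩,
    ⟨4009611202158269440, 0, 0, 0, [0]⟩]

set_option maxHeartbeats 400000000 in
/-- Every problem of this chunk passes (`mkCoset` elimination + `cosetOKD` + fast `σ` + depth + `BU`-evenness + label checks). -/
theorem probs00b_ok : probsOK cov covR hx hx1 D1 lxd 16 probs00b = true := by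
  decide +kernel

/-- Pointwise form. -/
theorem probs00b_all : ∀ x ∈ probs00b, probOK cov covR hx hx1 D1 lxd 16 x = true := by
  have h := probs00b_ok
  rwa [probsOK, List.all_eq_true] at h

end Summit.Ventures.QEC.Census.A1s_n192_k4_0fa3ae82
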